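import Summits.HubbardSuperconductivity.HubbardSuperconductivity.Theorems.AposterioriCapRgSsbToEvenTorusLroPairTransferRung
import Summits.HubbardSuperconductivity.HubbardSuperconductivity.Theorems.BalabanIRBirGroundStateAverageLRO
import Literature.MathematicalPhysics.QuantumLattice.HubbardSzSectorLadder
import Literature.MathematicalPhysics.QuantumLattice.FinDimSpectrumSectorGibbsLimit

/-!
# Crux `BirGroundStateAverageLRO` (item `stmt-HubbardSuperconductivity-2079`): the Anderson-tower / pair-charge-gap obstruction

The crux (`Theses.BalabanIR.BirGroundStateAverageLRO`, route BalabanIR, target) asks, on a window of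
couplings `0 < U₁ < U < U₂`, eventually in even `L`, the ground-state-AVERAGE `d`-wave pair long-range
order `c·L⁴·Re tr P ≤ Re tr (P Δ_d† Δ_d)` for the projection `P` onto the ground eigenspace of
`H = hubbardTorus 2 L 1 U` in the sector `(N, S^z = 0)`, `N = 2⌊(1-δ)L²/2⌋`.

This file adds to the crux's regime map (`Negative/RegimeMap.lean`: Yang's kinematic ceiling, the
carrier/Mott-corner ceiling, the weak-coupling ceiling and window floor) a ceiling of a different,
SPECTRAL kind — the Horsch–von der Linden / Koma–Tasaki "low-lying states" obstruction in its
charge-sector (Tasaki–Watanabe) reading, for the `d`-wave pair field of the Hubbard torus: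

* `pairGap_mul_lro_le_of_groundStateInSector` — for every real `U` and `a > 0` there is `C = C(U, a)`
  such that for every side `L`, every `m` in the bulk window `aL² ≤ m`, `m + 4 ≤ (2 - a)L²` and every
  normalised ground state `ψ` of `H` in the sector `(m + 2, S^z = 0)`, with
  `E_k = minEnergyOn H (szSector k 0)` and `S₋ = Re⟨ψ, Δ_d† Δ_d ψ⟩ = ‖Δ_d ψ‖²`:
  `(E_m + E_{m+4} - 2E_{m+2}) · S₋ ≤ C L²`.
  Proof (Koma–Tasaki 1994 (2.9) in sector form): by the own-bottom identity
  (`WcbcsSsbToTorusLRO.mc_dotProduct_doubleComm_of_eigen`)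
  `Re⟨ψ,(Δᴴ[H,Δ] - [H,Δ]Δᴴ)ψ⟩ = (Re⟨Δψ,HΔψ⟩ - E_{m+2}S₋) + (Re⟨Δᴴψ,HΔᴴψ⟩ - E_{m+2}S₊)`; the
  variational principle in the sectors `m ∋ Δψ` and `m + 4 ∋ Δᴴψ` bounds the right side below by
  `(E_m - E_{m+2})S₋ + (E_{m+4} - E_{m+2})S₊ = (E_m + E_{m+4} - 2E_{m+2})S₋ + (E_{m+4} - E_{m+2})(S₊ - S₋)`,
  and the three graded-locality budgets of the tree (`ptr_doubleComm_budget`: `O(L²)`;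
  `ptr_pairCommutator_budget`: `|S₊ - S₋| = O(L²)`; `ptr_twoParticleCost`: `|E_{m+2} - E_{m+4}| = O_{U,a}(1)`)
  finish.
* `avgBound_pairGap_mul_le`, `avgBound_pairGap_le` — in the crux's `let` vocabulary: for every `U` there
  is `C = C(U) ≥ 0` such that if the crux's inequality holds at ONE datum `(δ, U, c, L)` with `L ≥ 4`,
  `δ ∈ [0, 1/2]`, `c > 0`, then the PAIR CHARGE GAP of the crux's sector,
  `Δ₂(L) := E_{N-2} + E_{N+2} - 2E_N`, satisfies `Δ₂(L) ≤ C/(c·L²)` (one good ground state carries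
  `S₋ ≥ cL⁴`, `exists_groundState_le_of_trace_bound`; the bulk window holds with `a = 1/4`).
* `birGroundStateAverageLRO_witness_pairGap` — **every witness `(δ, U₁, U₂, c)` of the crux has, at every
  coupling `U` of its window, eventually in even `L`, `E_{N-2} + E_{N+2} - 2E_N ≤ C(U)/(c L²)`**: the
  crux forces gapless charge-`±2` excitations above the sector ground state at the rate `1/L²`
  (an "Anderson tower" of the pair `U(1)`), and `birGroundStateAverageLRO_pairGap` is the conditional
  reading. Contrapositives: `not_avgBound_of_pairGap_gt` (one datum) and
  `not_birGroundStateAverageLRO_witness_of_pairGap_unbounded` (`L² · Δ₂(L)` unbounded along even `L` at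
  one coupling of the window — e.g. a uniform pair charge gap `Δ₂(L) ≥ g > 0` — kills the quadruple).
  Physically `L²·Δ₂(L) → 4/χ_c` (`χ_c = ∂n/∂μ`), so the bound reads "no pair LRO beyond `C(U)·χ_c`":
  the fourth (spectral) corner of the regime map. `pairGapTowerWitness` is the registered stub.

Sources: T. Koma, H. Tasaki, J. Stat. Phys. 76 (1994) 745–803, Theorem 2.2, eq. (2.9) and §3.4
(lattice electrons, singlet-pair order operators, `C = (N_e - N)/2`); P. Horsch, W. von der Linden,
Z. Phys. B 72 (1988) 181; H. Tasaki, H. Watanabe, Phys. Rev. B 104 (2021) L180501 (charge gap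
`E_{N+q} + E_{N-q} - 2E_N` versus off-diagonal long-range order, `q = 2` for lattice fermions);
H. Tasaki, J. Stat. Phys. 174 (2019) 735 (Anderson's tower of states). All finite-dimensional linear
algebra over landed tree lemmas (the momentum-zero budgets of route AposterioriCapRg's rung
`stub_pairTransferRung` and the own-bottom identity of route WeakCouplingBCS); no definition and no
named fact is introduced; nothing here asserts a Theses decl.
-/

noncomputable section

namespace Summit.HubbardSuperconductivity.HubbardSuperconductivity.Theorems.BirGroundStateAverageLRO.Negative

-- summit = problem name (single-conjunct summit), D-0017
set_option linter.dupNamespace false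

open Matrix Finset Filter
open Literature.Probability.LatticeModels Literature.MathematicalPhysics.QuantumLattice
open Summit.HubbardSuperconductivity.HubbardSuperconductivity.Theorems
open Summit.HubbardSuperconductivity.HubbardSuperconductivity.Theses.BalabanIR
open scoped ComplexOrder

/-! ### §1 The sector form: pair charge gap × pair LRO ≤ C L² -/

/-- The real bookkeeping of the tower inequality: from the own-bottom identity
`dc = (a₋ - E S₋) + (a₊ - E S₊)`, the budgets `dc ≤ C_B L²`, `|E - E₊| ≤ C₃`, `|S₊ - S₋| ≤ C_P L²`, and
the variational bounds `E₋ S₋ ≤ a₋`, `E₊ S₊ ≤ a₊`: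
`(E₋ + E₊ - 2E) S₋ ≤ (C_B + C₃ C_P) L²`, because the left side is
`(E₋ - E)S₋ + (E₊ - E)S₊ + (E₊ - E)(S₋ - S₊)`. [folklore] -/
theorem pairGap_real {am ap E Em Ep Sm Sp dc CB C₃ CP L2 : ℝ}
    (hre : dc = (am - E * Sm) + (ap - E * Sp)) (hB : dc ≤ CB * L2) (hcost : |E - Ep| ≤ C₃)
    (h6 : |Sp - Sm| ≤ CP * L2) (ham : Em * Sm ≤ am) (hap : Ep * Sp ≤ ap) (hC₃ : 0 ≤ C₃) :
    (Em + Ep - 2 * E) * Sm ≤ (CB + C₃ * CP) * L2 := by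
  have hx : (Ep - E) * (Sm - Sp) ≤ C₃ * (CP * L2) :=
    calc (Ep - E) * (Sm - Sp) ≤ |(Ep - E) * (Sm - Sp)| := le_abs_self _
      _ = |E - Ep| * |Sp - Sm| := by rw [abs_mul, abs_sub_comm Ep E, abs_sub_comm Sm Sp]
      _ ≤ C₃ * (CP * L2) := mul_le_mul hcost h6 (abs_nonneg _) hC₃
  have h1 : (Em * Sm - E * Sm) + (Ep * Sp - E * Sp) ≤ CB * L2 := by
    rw [hre] at hB
    linarith
  have hid : (Em + Ep - 2 * E) * Sm =
      ((Em * Sm - E * Sm) + (Ep * Sp - E * Sp)) + (Ep - E) * (Sm - Sp) := by ring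
  rw [hid]
  linarith

/-- **Pair charge gap × pair long-range order is `O(L²)` for sector ground states of the Hubbard torus**
(Koma–Tasaki's (2.9) in its charge-sector reading; Tasaki–Watanabe). For every real `U` and `a > 0`
there is `C = C(U, a) ≥ 0` such that for every side `L`, every `m` with `aL² ≤ m`, `m + 4 ≤ (2 - a)L²`,
and every normalised ground state `ψ` of `H = hubbardTorus 2 L 1 U` in the sector `(m + 2, S^z = 0)`:
`(E_m + E_{m+4} - 2E_{m+2}) · Re⟨ψ, Δ_d† Δ_d ψ⟩ ≤ C L²`, `E_k = minEnergyOn H (szSector k 0)`,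
`Δ_d = pairField dWaveFormFactor L`. Own-bottom identity, the variational principle in the sectors
`m ∋ Δ_d ψ` and `m + 4 ∋ Δ_d† ψ`, and the tree's three graded-locality budgets (double commutator,
single commutator, two-particle cost). Koma–Tasaki, J. Stat. Phys. 76 (1994) 745, Theorem 2.2 (2.9),
§3.4; Tasaki–Watanabe, PRB 104 (2021) L180501. [cite: KomaTasaki1994, Theorem 2.2] -/
theorem pairGap_mul_lro_le_of_groundStateInSector (U a : ℝ) (ha : 0 < a) :
    ∃ C : ℝ, 0 ≤ C ∧ ∀ (L : ℕ) [NeZero L] (m : ℕ) (ψ : Fock (Orb (FermionTorus 2 L))),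
      a * (L : ℝ) ^ 2 ≤ (m : ℝ) → (m : ℝ) + 4 ≤ (2 - a) * (L : ℝ) ^ 2 →
      IsGroundStateInSector (hubbardTorus 2 L 1 U) (m + 2) 0 ψ → star ψ ⬝ᵥ ψ = 1 →
      ((hubbardTorus 2 L 1 U).minEnergyOn (szSector m 0) +
            (hubbardTorus 2 L 1 U).minEnergyOn (szSector (m + 4) 0) -
          2 * (hubbardTorus 2 L 1 U).minEnergyOn (szSector (m + 2) 0)) *
          (star ψ ⬝ᵥ ((pairField dWaveFormFactor L)ᴴ * pairField dWaveFormFactor L) *ᵥ ψ).re ≤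
        C * (L : ℝ) ^ 2 := by
  obtain ⟨CP, hCP0, hCP⟩ := ptr_pairCommutator_budget
  obtain ⟨CB, hCB0, hCB⟩ := ptr_doubleComm_budget U
  obtain ⟨C₃, hC₃0, hC₃⟩ := ptr_twoParticleCost U a ha
  refine ⟨CB + C₃ * CP, by positivity, fun L _ m ψ hm1 hm2 hgs hψ1 => ?_⟩
  -- parity: the sector `(m + 2, S^z = 0)` is empty unless `m + 2` is even
  have hev : Even (m + 2) := by
    by_contra hodd
    exact SsbToEvenTorusLro.Negative.not_isGroundStateInSector_zero_odd
      (Nat.not_even_iff_odd.1 hodd) _ _ hgs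
  obtain ⟨n, hn⟩ := hev
  obtain ⟨hψK, -, hHψ⟩ := hgs
  set H := hubbardTorus 2 L 1 U with hH
  set P := pairField dWaveFormFactor L with hP
  -- sector bookkeeping at momentum zero
  have h1 : P *ᵥ ψ ∈ szSector m 0 := by
    have h := WcbcsSsbToTorusLRO.pairFieldAt_mulVec_mem_szSector dWaveFormFactor
      (0 : TorusSite 2 L) (N := m + 2) (by omega) hψK
    rwa [pairFieldAt_zero, Nat.add_sub_cancel] at h
  have h2 : Pᴴ *ᵥ ψ ∈ szSector (m + 4) 0 := by
    have h := WcbcsSsbToTorusLRO.conjTranspose_pairFieldAt_mulVec_mem_szSector dWaveFormFactor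
      (0 : TorusSite 2 L) hψK
    rwa [pairFieldAt_zero] at h
  -- the two-particle cost `|E_{m+2} - E_{m+4}| ≤ C₃`
  have hcost : |H.minEnergyOn (szSector (m + 2) 0) - H.minEnergyOn (szSector (m + 4) 0)| ≤ C₃ := by
    have hm2 : m + 2 = 2 * n := by omega
    have hm4 : m + 4 = 2 * n + 2 := by omega
    have hnr : (m : ℝ) + 2 = 2 * (n : ℝ) := by exact_mod_cast hm2
    rw [hm2, hm4]
    exact hC₃ L n (by linarith) (by linarith)
  have hHerm : H.IsHermitian := LiebThm1.hamiltonian_isHermitian (fermionTorusGraph 2 L) 1 U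
  have hψre : (star ψ ⬝ᵥ ψ).re = 1 := by rw [hψ1, Complex.one_re]
  -- Gram identities `‖Pψ‖² = ⟨ψ,PᴴPψ⟩`, `‖Pᴴψ‖² = ⟨ψ,PPᴴψ⟩`
  have hSm : star (P *ᵥ ψ) ⬝ᵥ (P *ᵥ ψ) = star ψ ⬝ᵥ ((Pᴴ * P) *ᵥ ψ) :=
    Literature.MathematicalPhysics.QuantumLattice.star_mulVec_dotProduct_mulVec P P ψ
  have hSp : star (Pᴴ *ᵥ ψ) ⬝ᵥ (Pᴴ *ᵥ ψ) = star ψ ⬝ᵥ ((P * Pᴴ) *ᵥ ψ) := by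
    rw [Literature.MathematicalPhysics.QuantumLattice.star_mulVec_dotProduct_mulVec,
      conjTranspose_conjTranspose]
  -- the single-commutator budget at `ψ`
  have h6 : |(star ψ ⬝ᵥ ((P * Pᴴ) *ᵥ ψ)).re - (star ψ ⬝ᵥ ((Pᴴ * P) *ᵥ ψ)).re| ≤
      CP * (L : ℝ) ^ 2 := by
    have h := hCP L ψ
    rw [sub_mulVec, dotProduct_sub, Complex.sub_re, hψre, mul_one, abs_sub_comm] at h
    exact h
  -- the variational principle in the two neighbouring sectors, homogeneous form
  have ham : H.minEnergyOn (szSector m 0) * (star (P *ᵥ ψ) ⬝ᵥ (P *ᵥ ψ)).re ≤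
      (star (P *ᵥ ψ) ⬝ᵥ (H *ᵥ (P *ᵥ ψ))).re :=
    mul_norm_le_of_unit_bound_submodule H (szSector m 0)
      (fun v hv hv1 => minEnergyOn_le_rayleigh_of_mem hHerm _ hv hv1) h1
  have hap : H.minEnergyOn (szSector (m + 4) 0) * (star (Pᴴ *ᵥ ψ) ⬝ᵥ (Pᴴ *ᵥ ψ)).re ≤
      (star (Pᴴ *ᵥ ψ) ⬝ᵥ (H *ᵥ (Pᴴ *ᵥ ψ))).re :=
    mul_norm_le_of_unit_bound_submodule H (szSector (m + 4) 0)
      (fun v hv hv1 => minEnergyOn_le_rayleigh_of_mem hHerm _ hv hv1) h2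
  rw [hSm] at ham
  rw [hSp] at hap
  -- the own-bottom identity and the double-commutator budget
  have hDC := WcbcsSsbToTorusLRO.mc_dotProduct_doubleComm_of_eigen hHerm hHψ P
  have hre := congrArg Complex.re hDC
  rw [Complex.add_re, Complex.sub_re, Complex.sub_re, Complex.re_ofReal_mul,
    Complex.re_ofReal_mul, hSm, hSp] at hre
  have hB := hCB L ψ
  rw [hψre, mul_one] at hB
  exact pairGap_real hre ((le_abs_self _).trans hB) hcost h6 ham hap hC₃0

/-! ### §2 The crux's sector: the bulk window and the one-datum form -/

/-- `N = 2⌊(1-δ)L²/2⌋` has `(1-δ)L² - 2 ≤ N ≤ (1-δ)L²` for `δ ≤ 1`. [folklore] -/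
theorem cast_pairNumber_mem_Icc {δ : ℝ} (hδ1 : δ ≤ 1) (L : ℕ) :
    (1 - δ) * (L : ℝ) ^ 2 - 2 ≤ ((2 * ⌊(1 - δ) * (L : ℝ) ^ 2 / 2⌋₊ : ℕ) : ℝ) ∧
      ((2 * ⌊(1 - δ) * (L : ℝ) ^ 2 / 2⌋₊ : ℕ) : ℝ) ≤ (1 - δ) * (L : ℝ) ^ 2 := by
  have hy : 0 ≤ (1 - δ) * (L : ℝ) ^ 2 / 2 := by
    have : (0 : ℝ) ≤ (L : ℝ) ^ 2 := by positivity
    have : 0 ≤ 1 - δ := by linarith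
    positivity
  have hfl := Nat.floor_le hy
  have hlt := Nat.lt_floor_add_one ((1 - δ) * (L : ℝ) ^ 2 / 2)
  push_cast
  constructor <;> linarith

/-- **The bulk window of the crux's sector.** For `L ≥ 4` and `δ ∈ [0, 1/2]`, `N = 2⌊(1-δ)L²/2⌋`
satisfies `2 ≤ N`, `L²/4 ≤ N - 2` and `(N - 2) + 4 ≤ (2 - 1/4)L²` (so `m = N - 2` is admissible in
`pairGap_mul_lro_le_of_groundStateInSector` with `a = 1/4`). [folklore] -/
theorem pairNumber_window (L : ℕ) (hL : 4 ≤ L) {δ : ℝ} (hδ0 : 0 ≤ δ) (hδ : δ ≤ 1 / 2) :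
    2 ≤ 2 * ⌊(1 - δ) * (L : ℝ) ^ 2 / 2⌋₊ ∧
      (1 / 4 : ℝ) * (L : ℝ) ^ 2 ≤ ((2 * ⌊(1 - δ) * (L : ℝ) ^ 2 / 2⌋₊ - 2 : ℕ) : ℝ) ∧
      ((2 * ⌊(1 - δ) * (L : ℝ) ^ 2 / 2⌋₊ - 2 : ℕ) : ℝ) + 4 ≤ (2 - 1 / 4) * (L : ℝ) ^ 2 := by
  obtain ⟨hlo, hhi⟩ := cast_pairNumber_mem_Icc (δ := δ) (by linarith) L
  set N : ℕ := 2 * ⌊(1 - δ) * (L : ℝ) ^ 2 / 2⌋₊ with hN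
  have hL4 : (4 : ℝ) ≤ (L : ℝ) := by exact_mod_cast hL
  have hL16 : (16 : ℝ) ≤ (L : ℝ) ^ 2 := by nlinarith
  have hN6 : (6 : ℝ) ≤ (N : ℝ) := by nlinarith
  have h2N : 2 ≤ N := by
    have : (2 : ℝ) ≤ (N : ℝ) := by linarith
    exact_mod_cast this
  have hcast : ((N - 2 : ℕ) : ℝ) = (N : ℝ) - 2 := by
    rw [Nat.cast_sub h2N]
    norm_num
  refine ⟨h2N, ?_, ?_⟩
  · rw [hcast]
    nlinarith
  · rw [hcast]
    nlinarith

/-- **One datum of the crux bounds the pair charge gap of its sector** (product form). For every real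
`U` there is `C = C(U) ≥ 0` such that: if the crux's average bound `c·L⁴·Re tr P ≤ Re tr (P Δ_d† Δ_d)`
holds at ONE datum `(δ, U, c, L)` with `L ≥ 4`, `δ ∈ [0, 1/2]`, `c ≥ 0`, then, with `N = 2⌊(1-δ)L²/2⌋`
and `E_k = minEnergyOn H (szSector k 0)`, `(E_{N-2} + E_{N+2} - 2E_N) · c L⁴ ≤ C L²` (one normalised
ground state of the sector carries `Re⟨ψ, Δ_d† Δ_d ψ⟩ ≥ cL⁴`, `exists_groundState_le_of_trace_bound`,
and `pairGap_mul_lro_le_of_groundStateInSector` at `a = 1/4`, `m = N - 2`). The inner `let`s are the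
crux's. Koma–Tasaki (1994) Theorem 2.2; Tasaki–Watanabe (2021). [cite: KomaTasaki1994, Theorem 2.2] -/
theorem avgBound_pairGap_mul_le (U : ℝ) :
    ∃ C : ℝ, 0 ≤ C ∧ ∀ (L : ℕ) [NeZero L], 4 ≤ L → ∀ {δ c : ℝ}, 0 ≤ δ → δ ≤ 1 / 2 → 0 ≤ c →
      (let N : ℕ := 2 * ⌊(1 - δ) * (L : ℝ) ^ 2 / 2⌋₊
        let H := hubbardTorus 2 L 1 U
        let S := szSector (Λ := FermionTorus 2 L) N 0
        let E₀ := S ⊓ Module.End.eigenspace (Matrix.toLin' H) ((H.minEnergyOn S : ℝ) : ℂ)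
        let P := projMatrix (E₀.map (Fock.toEuclidean (ι := Orb (FermionTorus 2 L)) :
          Fock (Orb (FermionTorus 2 L)) →ₗ[ℂ] EuclideanSpace ℂ (Finset (Orb (FermionTorus 2 L)))))
        c * (L : ℝ) ^ 4 * P.trace.re ≤
          (P * ((pairField dWaveFormFactor L)ᴴ * pairField dWaveFormFactor L)).trace.re) →
      ((hubbardTorus 2 L 1 U).minEnergyOn (szSector (2 * ⌊(1 - δ) * (L : ℝ) ^ 2 / 2⌋₊ - 2) 0) +
            (hubbardTorus 2 L 1 U).minEnergyOn (szSector (2 * ⌊(1 - δ) * (L : ℝ) ^ 2 / 2⌋₊ + 2) 0) -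
          2 * (hubbardTorus 2 L 1 U).minEnergyOn (szSector (2 * ⌊(1 - δ) * (L : ℝ) ^ 2 / 2⌋₊) 0)) *
          (c * (L : ℝ) ^ 4) ≤ C * (L : ℝ) ^ 2 := by
  obtain ⟨C, hC0, hC⟩ := pairGap_mul_lro_le_of_groundStateInSector U (1 / 4) (by norm_num)
  refine ⟨C, hC0, fun L _ hL δ c hδ0 hδ hc h => ?_⟩
  obtain ⟨h2N, hw1, hw2⟩ := pairNumber_window L hL hδ0 hδ
  set N : ℕ := 2 * ⌊(1 - δ) * (L : ℝ) ^ 2 / 2⌋₊ with hN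
  -- one good ground state
  obtain ⟨ψ, hgs, hψ1, hlro⟩ := exists_groundState_le_of_trace_bound L 1 U δ c (by linarith) h
  -- the sector theorem at `m = N - 2`
  have hm2 : N - 2 + 2 = N := Nat.sub_add_cancel h2N
  have hm4 : N - 2 + 4 = N + 2 := by omega
  have key := hC L (N - 2) ψ hw1 hw2 (by rw [hm2]; exact hgs) hψ1
  rw [hm2, hm4] at key
  set g : ℝ := (hubbardTorus 2 L 1 U).minEnergyOn (szSector (N - 2) 0) +
      (hubbardTorus 2 L 1 U).minEnergyOn (szSector (N + 2) 0) -
    2 * (hubbardTorus 2 L 1 U).minEnergyOn (szSector N 0) with hg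
  have hL2 : 0 ≤ C * (L : ℝ) ^ 2 := by positivity
  have hcL : 0 ≤ c * (L : ℝ) ^ 4 := by positivity
  rcases le_or_gt g 0 with hg0 | hg0
  · exact (mul_nonpos_of_nonpos_of_nonneg hg0 hcL).trans hL2
  · exact (mul_le_mul_of_nonneg_left hlro hg0.le).trans key

/-- **One datum of the crux bounds the pair charge gap of its sector**: with `C = C(U)` as above, the
crux's inequality at `(δ, U, c, L)` (`L ≥ 4`, `δ ∈ [0, 1/2]`, `c > 0`) forces
`E_{N-2} + E_{N+2} - 2E_N ≤ C / (c L²)`. Koma–Tasaki (1994) Theorem 2.2; Tasaki–Watanabe (2021).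
[cite: KomaTasaki1994, Theorem 2.2] -/
theorem avgBound_pairGap_le (U : ℝ) :
    ∃ C : ℝ, 0 ≤ C ∧ ∀ (L : ℕ) [NeZero L], 4 ≤ L → ∀ {δ c : ℝ}, 0 ≤ δ → δ ≤ 1 / 2 → 0 < c →
      (let N : ℕ := 2 * ⌊(1 - δ) * (L : ℝ) ^ 2 / 2⌋₊
        let H := hubbardTorus 2 L 1 U
        let S := szSector (Λ := FermionTorus 2 L) N 0
        let E₀ := S ⊓ Module.End.eigenspace (Matrix.toLin' H) ((H.minEnergyOn S : ℝ) : ℂ)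
        let P := projMatrix (E₀.map (Fock.toEuclidean (ι := Orb (FermionTorus 2 L)) :
          Fock (Orb (FermionTorus 2 L)) →ₗ[ℂ] EuclideanSpace ℂ (Finset (Orb (FermionTorus 2 L)))))
        c * (L : ℝ) ^ 4 * P.trace.re ≤
          (P * ((pairField dWaveFormFactor L)ᴴ * pairField dWaveFormFactor L)).trace.re) →
      (hubbardTorus 2 L 1 U).minEnergyOn (szSector (2 * ⌊(1 - δ) * (L : ℝ) ^ 2 / 2⌋₊ - 2) 0) +
            (hubbardTorus 2 L 1 U).minEnergyOn (szSector (2 * ⌊(1 - δ) * (L : ℝ) ^ 2 / 2⌋₊ + 2) 0) -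
          2 * (hubbardTorus 2 L 1 U).minEnergyOn (szSector (2 * ⌊(1 - δ) * (L : ℝ) ^ 2 / 2⌋₊) 0) ≤
        C / (c * (L : ℝ) ^ 2) := by
  obtain ⟨C, hC0, hC⟩ := avgBound_pairGap_mul_le U
  refine ⟨C, hC0, fun L _ hL δ c hδ0 hδ hc h => ?_⟩
  have key := hC L hL hδ0 hδ hc.le h
  have hL0 : (0 : ℝ) < (L : ℝ) := by exact_mod_cast Nat.pos_of_ne_zero (NeZero.ne L)
  have hcL2 : 0 < c * (L : ℝ) ^ 2 := by positivity
  rw [le_div_iff₀ hcL2]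
  have hL2 : (0 : ℝ) < (L : ℝ) ^ 2 := by positivity
  -- `g · cL⁴ ≤ CL²` divided by `L² > 0`
  have e : ∀ g : ℝ, g * (c * (L : ℝ) ^ 4) = g * (c * (L : ℝ) ^ 2) * (L : ℝ) ^ 2 := fun g => by ring
  rw [e] at key
  exact le_of_mul_le_mul_right (by linarith) hL2

/-- **Contrapositive, one datum.** With `C = C(U)` of `avgBound_pairGap_le`: if at `(δ, U, L)` (`L ≥ 4`,
`δ ∈ [0,1/2]`) the pair charge gap of the crux's sector exceeds `C/(cL²)` (`c > 0`), then the crux's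
average bound FAILS at the datum `(δ, U, c, L)`. [cite: KomaTasaki1994, Theorem 2.2] -/
theorem not_avgBound_of_pairGap_gt (U : ℝ) :
    ∃ C : ℝ, 0 ≤ C ∧ ∀ (L : ℕ) [NeZero L], 4 ≤ L → ∀ {δ c : ℝ}, 0 ≤ δ → δ ≤ 1 / 2 → 0 < c →
      C / (c * (L : ℝ) ^ 2) <
        (hubbardTorus 2 L 1 U).minEnergyOn (szSector (2 * ⌊(1 - δ) * (L : ℝ) ^ 2 / 2⌋₊ - 2) 0) +
            (hubbardTorus 2 L 1 U).minEnergyOn (szSector (2 * ⌊(1 - δ) * (L : ℝ) ^ 2 / 2⌋₊ + 2) 0) -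
          2 * (hubbardTorus 2 L 1 U).minEnergyOn (szSector (2 * ⌊(1 - δ) * (L : ℝ) ^ 2 / 2⌋₊) 0) →
      ¬ (let N : ℕ := 2 * ⌊(1 - δ) * (L : ℝ) ^ 2 / 2⌋₊
        let H := hubbardTorus 2 L 1 U
        let S := szSector (Λ := FermionTorus 2 L) N 0
        let E₀ := S ⊓ Module.End.eigenspace (Matrix.toLin' H) ((H.minEnergyOn S : ℝ) : ℂ)
        let P := projMatrix (E₀.map (Fock.toEuclidean (ι := Orb (FermionTorus 2 L)) :
          Fock (Orb (FermionTorus 2 L)) →ₗ[ℂ] EuclideanSpace ℂ (Finset (Orb (FermionTorus 2 L)))))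
        c * (L : ℝ) ^ 4 * P.trace.re ≤
          (P * ((pairField dWaveFormFactor L)ᴴ * pairField dWaveFormFactor L)).trace.re) := by
  obtain ⟨C, hC0, hC⟩ := avgBound_pairGap_le U
  exact ⟨C, hC0, fun L _ hL δ c hδ0 hδ hc hgap h => (hC L hL hδ0 hδ hc h).not_gt hgap⟩

/-! ### §3 The witness form: the crux forces an Anderson tower -/

/-- **Every witness of the crux has a gapless pair tower at every coupling of its window.** If
`(δ, U₁, U₂, c)` with `δ ∈ (0, 1/2)`, `c > 0` satisfies the crux's eventual average bound at every
`U ∈ (U₁, U₂)`, then for every such `U` there are `C = C(U) ≥ 0` and `L₀` with, for all even `L ≥ L₀`,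
`E_{N-2} + E_{N+2} - 2E_N ≤ C/(c L²)` (`N = 2⌊(1-δ)L²/2⌋`, `E_k = minEnergyOn (hubbardTorus 2 L 1 U)
(szSector k 0)`): the sector ground states carry charge-`±2` excitations of energy `O(1/L²)`.
Koma–Tasaki, J. Stat. Phys. 76 (1994) 745, Theorem 2.2 and §3.4; Tasaki–Watanabe, PRB 104 (2021)
L180501; Tasaki, J. Stat. Phys. 174 (2019) 735. [cite: KomaTasaki1994, Theorem 2.2] -/
theorem birGroundStateAverageLRO_witness_pairGap {δ U₁ U₂ c : ℝ}
    (hδ : δ ∈ Set.Ioo (0:ℝ) (1/2)) (hc : 0 < c)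
    (h : ∀ U ∈ Set.Ioo U₁ U₂, ∃ L₀ : ℕ, ∀ (L : ℕ) [NeZero L], L₀ ≤ L → Even L →
      let N : ℕ := 2 * ⌊(1 - δ) * (L : ℝ) ^ 2 / 2⌋₊
      let H := hubbardTorus 2 L 1 U
      let S := szSector (Λ := FermionTorus 2 L) N 0
      let E₀ := S ⊓ Module.End.eigenspace (Matrix.toLin' H) ((H.minEnergyOn S : ℝ) : ℂ)
      let P := projMatrix (E₀.map (Fock.toEuclidean (ι := Orb (FermionTorus 2 L)) :
        Fock (Orb (FermionTorus 2 L)) →ₗ[ℂ] EuclideanSpace ℂ (Finset (Orb (FermionTorus 2 L)))))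
      c * (L : ℝ) ^ 4 * P.trace.re ≤
        (P * ((pairField dWaveFormFactor L)ᴴ * pairField dWaveFormFactor L)).trace.re) :
    ∀ U ∈ Set.Ioo U₁ U₂, ∃ C : ℝ, 0 ≤ C ∧ ∃ L₀ : ℕ, ∀ (L : ℕ) [NeZero L], L₀ ≤ L → Even L →
      (hubbardTorus 2 L 1 U).minEnergyOn (szSector (2 * ⌊(1 - δ) * (L : ℝ) ^ 2 / 2⌋₊ - 2) 0) +
            (hubbardTorus 2 L 1 U).minEnergyOn (szSector (2 * ⌊(1 - δ) * (L : ℝ) ^ 2 / 2⌋₊ + 2) 0) -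
          2 * (hubbardTorus 2 L 1 U).minEnergyOn (szSector (2 * ⌊(1 - δ) * (L : ℝ) ^ 2 / 2⌋₊) 0) ≤
        C / (c * (L : ℝ) ^ 2) := by
  intro U hU
  obtain ⟨C, hC0, hC⟩ := avgBound_pairGap_le U
  obtain ⟨L₀, hL₀⟩ := h U hU
  refine ⟨C, hC0, max L₀ 4, fun L _ hL hLe => ?_⟩
  exact hC L (le_of_max_le_right hL) hδ.1.le (by linarith [hδ.2]) hc
    (hL₀ L (le_of_max_le_left hL) hLe)

/-- **Conditional reading: the crux forces an Anderson tower.** If `BirGroundStateAverageLRO` holds,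
its data `(δ, U₁, U₂, c)` satisfy: for every `U ∈ (U₁, U₂)`, eventually in even `L`, the pair charge gap
of the sector `(2⌊(1-δ)L²/2⌋, S^z = 0)` of `hubbardTorus 2 L 1 U` is at most `C(U)/(c L²)`.
[cite: KomaTasaki1994, Theorem 2.2] -/
theorem birGroundStateAverageLRO_pairGap (h : BirGroundStateAverageLRO) :
    ∃ δ ∈ Set.Ioo (0:ℝ) (1/2), ∃ U₁ U₂ c : ℝ, 0 < U₁ ∧ U₁ < U₂ ∧ 0 < c ∧
      ∀ U ∈ Set.Ioo U₁ U₂, ∃ C : ℝ, 0 ≤ C ∧ ∃ L₀ : ℕ, ∀ (L : ℕ) [NeZero L], L₀ ≤ L → Even L →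
        (hubbardTorus 2 L 1 U).minEnergyOn (szSector (2 * ⌊(1 - δ) * (L : ℝ) ^ 2 / 2⌋₊ - 2) 0) +
              (hubbardTorus 2 L 1 U).minEnergyOn
                (szSector (2 * ⌊(1 - δ) * (L : ℝ) ^ 2 / 2⌋₊ + 2) 0) -
            2 * (hubbardTorus 2 L 1 U).minEnergyOn (szSector (2 * ⌊(1 - δ) * (L : ℝ) ^ 2 / 2⌋₊) 0) ≤
          C / (c * (L : ℝ) ^ 2) := by
  obtain ⟨δ, hδ, U₁, U₂, c, hU₁, hU₁₂, hc, hw⟩ := h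
  exact ⟨δ, hδ, U₁, U₂, c, hU₁, hU₁₂, hc, birGroundStateAverageLRO_witness_pairGap hδ hc hw⟩

/-- **Contrapositive, witness form: pair-incompressibility at one coupling kills the quadruple.** If for
some `U ∈ (U₁, U₂)` the rescaled pair charge gap `L² · (E_{N-2} + E_{N+2} - 2E_N)` of the sector
`(2⌊(1-δ)L²/2⌋, 0)` of `hubbardTorus 2 L 1 U` is unbounded along even `L` (for every `C` and `L₀` some
even `L ≥ L₀` exceeds `C`) — in particular if these sector ground states have a pair charge gap
`≥ g > 0` uniformly in `L` — then `(δ, U₁, U₂, c)` (`δ ∈ (0,1/2)`, `c > 0`) is NOT a witness of the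
crux. [cite: KomaTasaki1994, Theorem 2.2] -/
theorem not_birGroundStateAverageLRO_witness_of_pairGap_unbounded {δ U₁ U₂ c : ℝ}
    (hδ : δ ∈ Set.Ioo (0:ℝ) (1/2)) (hc : 0 < c)
    (hg : ∃ U ∈ Set.Ioo U₁ U₂, ∀ (C : ℝ) (L₀ : ℕ), ∃ (L : ℕ) (_ : NeZero L), L₀ ≤ L ∧ Even L ∧
      C < (L : ℝ) ^ 2 *
        ((hubbardTorus 2 L 1 U).minEnergyOn (szSector (2 * ⌊(1 - δ) * (L : ℝ) ^ 2 / 2⌋₊ - 2) 0) +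
            (hubbardTorus 2 L 1 U).minEnergyOn (szSector (2 * ⌊(1 - δ) * (L : ℝ) ^ 2 / 2⌋₊ + 2) 0) -
          2 * (hubbardTorus 2 L 1 U).minEnergyOn (szSector (2 * ⌊(1 - δ) * (L : ℝ) ^ 2 / 2⌋₊) 0))) :
    ¬ (∀ U ∈ Set.Ioo U₁ U₂, ∃ L₀ : ℕ, ∀ (L : ℕ) [NeZero L], L₀ ≤ L → Even L →
      let N : ℕ := 2 * ⌊(1 - δ) * (L : ℝ) ^ 2 / 2⌋₊
      let H := hubbardTorus 2 L 1 U
      let S := szSector (Λ := FermionTorus 2 L) N 0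
      let E₀ := S ⊓ Module.End.eigenspace (Matrix.toLin' H) ((H.minEnergyOn S : ℝ) : ℂ)
      let P := projMatrix (E₀.map (Fock.toEuclidean (ι := Orb (FermionTorus 2 L)) :
        Fock (Orb (FermionTorus 2 L)) →ₗ[ℂ] EuclideanSpace ℂ (Finset (Orb (FermionTorus 2 L)))))
      c * (L : ℝ) ^ 4 * P.trace.re ≤
        (P * ((pairField dWaveFormFactor L)ᴴ * pairField dWaveFormFactor L)).trace.re) := by
  intro hw
  obtain ⟨U, hU, hg⟩ := hg
  obtain ⟨C, hC0, L₀, hL₀⟩ := birGroundStateAverageLRO_witness_pairGap hδ hc hw U hU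
  obtain ⟨L, hLz, hL, hLe, hlt⟩ := hg (C / c) L₀
  haveI := hLz
  have hb := hL₀ L hL hLe
  have hL0 : (0 : ℝ) < (L : ℝ) := by exact_mod_cast Nat.pos_of_ne_zero (NeZero.ne L)
  have hL2 : (0 : ℝ) < (L : ℝ) ^ 2 := by positivity
  -- `L² · gap ≤ L² · C/(cL²) = C/c`
  have hmul := mul_le_mul_of_nonneg_left hb hL2.le
  have e : (L : ℝ) ^ 2 * (C / (c * (L : ℝ) ^ 2)) = C / c := by
    field_simp
  rw [e] at hmul
  exact absurd (hlt.trans_le hmul) (lt_irrefl _)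

/-! ### §4 The registered stub -/

/-- **Stub `pairGapTowerWitness`** (crux `BirGroundStateAverageLRO`, item 2079; prover seat 2): the
witness form `birGroundStateAverageLRO_witness_pairGap` as registered — every witness `(δ, U₁, U₂, c)` of
the crux has, at every coupling of its window, eventually in even `L`, pair charge gap
`E_{N-2} + E_{N+2} - 2E_N ≤ C(U)/(c L²)` in its sector. [cite: KomaTasaki1994, Theorem 2.2] -/
theorem pairGapTowerWitness : ∀ (δ U₁ U₂ c : ℝ), δ ∈ Set.Ioo (0:ℝ) (1/2) → 0 < c → (∀ U ∈ Set.Ioo U₁ U₂, ∃ L₀ : ℕ, ∀ (L : ℕ) [NeZero L], L₀ ≤ L → Even L → (let N : ℕ := 2 * ⌊(1 - δ) * (L : ℝ) ^ 2 / 2⌋₊; let H := Literature.MathematicalPhysics.QuantumLattice.hubbardTorus 2 L 1 U; let S := Literature.MathematicalPhysics.QuantumLattice.szSector (Λ := Literature.MathematicalPhysics.QuantumLattice.FermionTorus 2 L) N 0; let E₀ := S ⊓ Module.End.eigenspace (Matrix.toLin' H) ((H.minEnergyOn S : ℝ) : ℂ); let P := Literature.MathematicalPhysics.QuantumLattice.projMatrix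 (E₀.map (Literature.MathematicalPhysics.QuantumLattice.Fock.toEuclidean (ι := Literature.MathematicalPhysics.QuantumLattice.Orb (Literature.MathematicalPhysics.QuantumLattice.FermionTorus 2 L)) : Literature.MathematicalPhysics.QuantumLattice.Fock (Literature.MathematicalPhysics.QuantumLattice.Orb (Literature.MathematicalPhysics.QuantumLattice.FermionTorus 2 L)) →ₗ[ℂ] EuclideanSpace ℂ (Finset (Literature.MathematicalPhysics.QuantumLattice.Orb (Literature.MathematicalPhysics.QuantumLattice.FermionTorus 2 L))))); c * (L : ℝ) ^ 4 * P.trace.re ≤ (P * (Matrix.conjTranspose (Literature.MathematicalPhysics.QuantumLattice.pairField Literature.MathematicalPhysics.QuantumLattice.dWaveFormFactor L) * Literature.MathematicalPhysics.QuantumLattice.pairField Literature.MathematicalPhysics.QuantumLattice.dWaveFormFactor L)).trace.re)) → ∀ U ∈ Set.Ioo U₁ U₂, ∃ C : ℝ, 0 ≤ C ∧ ∃ L₀ : ℕ, ∀ (L : ℕ) [NeZero L], L₀ ≤ L → Even L → (Literature.MathematicalPhysics.QuantumLattice.hubbardTorus 2 L 1 U).minEnergyOn (Literature.MathematicalPhysics.QuantumLattice.szSector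 (2 * ⌊(1 - δ) * (L : ℝ) ^ 2 / 2⌋₊ - 2) 0) + (Literature.MathematicalPhysics.QuantumLattice.hubbardTorus 2 L 1 U).minEnergyOn (Literature.MathematicalPhysics.QuantumLattice.szSector (2 * ⌊(1 - δ) * (L : ℝ) ^ 2 / 2⌋₊ + 2) 0) - 2 * (Literature.MathematicalPhysics.QuantumLattice.hubbardTorus 2 L 1 U).minEnergyOn (Literature.MathematicalPhysics.QuantumLattice.szSector (2 * ⌊(1 - δ) * (L : ℝ) ^ 2 / 2⌋₊) 0) ≤ C / (c * (L : ℝ) ^ 2) :=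
  fun _ _ _ _ hδ hc h => birGroundStateAverageLRO_witness_pairGap hδ hc h

end Summit.HubbardSuperconductivity.HubbardSuperconductivity.Theorems.BirGroundStateAverageLRO.Negative

end
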